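import Summits.Ventures.YMGap.Thresholds.StateLipschitzStarDim
import Summits.Ventures.YMGap.Thresholds.CouplingDerivativeSeries
import HarnessLib

/-!
# Venture YMGap — C-DIFF for every `SU(N)` in every dimension `d`, part 1: the response series `Σ_q Cov_b(F, W_q)`
# under a one-link modulus — domination, limit of the torus derivatives (Tannery), continuity in the coupling

HONEST FRAMING: venture file of the cell `pub-ymgap` (QuantumFields programme), seat ds-1; general-`d` form of
`CouplingDerivativeSeriesSUN` (`d = 4`).  Strong-coupling LATTICE statements for `SU(N)` lattice Yang–Mills on `ℤ^d`,
Wilson action at tree coupling `b`, inside the one-sided vertex-star window generated by `OneLinkKRModulus N R K`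
(`2(d−1) b₁/N ≤ R`, door `P_d(K b₁/N) < 1`); series estimates only; nothing about the continuum or the Clay problem.

For a Lipschitz cylinder `F` (support `Λ`, constant `K_F`, links based within `D` of `x₀`) and the (unique) DLR state
`μ` at `0 ≤ b ≤ b₁`:
* `tendsto_cov_plaquette_dim` — torus covariances `Cov_{torusState b (L+1)}(F, W_q) → Cov_μ(F, W_q)`;
* `abs_cov_plaquette_le_star_dim` — `|Cov_μ(F, W_q)| ≤ A_N r^{‖x₀ − x_q‖₁}` (`A = 4(2√N)² e^{κ(D+3)}(#Λ K_F)(16N³)`,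
  `r = e^{−κ/d}`, `κ = κ_d(R_G^{(d)}(K b₁/N))`); `summable_cov_plaquette_star_dim`;
* `tendsto_responseSum_dim` — `Σ_y Σ_{i<j} Cov_{torusState}(F, W_{(s_L y;i,j)}) → Σ_q Cov_μ(F, W_q)` (Tannery);
* `continuousOn_integral_dim`, `continuousOn_responseSum_dim` — along any DLR selection on `[0, b₁]`, `⟨F⟩_b` and
  `Σ_q Cov_b(F, W_q)` are continuous in `b`.

References (mechanism only): B. Simon (1993) §II.12; R. L. Dobrushin, S. B. Shlosman (1985/87).
-/

noncomputable section

open MeasureTheory ProbabilityTheory Function Finset Filter Topology Real Set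
open scoped NNReal
open Literature.Probability.LatticeModels (Torus.proj Torus.proj_apply HasUniqueGibbsMeasure)
open Literature.MathematicalPhysics.QuantumLattice (LGConfig ZdEdge ZdPlaquette plaquetteEdges torusLift torusEdge
  fundamentalRep continuous_fundamentalRep ymSpecification ymGibbsMeasures)
open Literature.MathematicalPhysics.QuantumFieldTheory hiding ZdEdge
open Literature.MathematicalPhysics.QuantumFieldTheory.Balaban1983to89.StrongCouplingDobrushinWindow (OneLinkKRModulus)
open Summit.Ventures.YMGap.StarResolventDim (Delta gaugeR doorPoly Delta_pos_of_door doorPoly_lt_one_mono gaugeR_lt_one_of_door)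
open Summit.Ventures.YMGap.StarLimit (continuous_of_isLipschitzCylinder)
open Summit.Ventures.YMGap.RobustBall (l1 numOrient)
open Summit.Ventures.YMGap.LinearResponseBound (summable_and_tsum_base_le)

namespace Summit.Ventures.YMGap.CouplingResponse

variable {d N : ℕ}

/-! ### §1 One plaquette -/

section OnePlaquette

/-- The `SU(N)` plaquette observable `W_q` is continuous and bounded by `|W_q 1| + 2·4N³`. -/
theorem continuous_zdPlaquetteObs_dim (q : ZdPlaquette d) :
    Continuous (zdPlaquetteObs (d := d) (fundamentalRep (Fin N)) q.1 q.2.1.1 q.2.1.2) ∧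
      ∀ U, |zdPlaquetteObs (d := d) (fundamentalRep (Fin N)) q.1 q.2.1.1 q.2.1.2 U| ≤
        |zdPlaquetteObs (d := d) (fundamentalRep (Fin N)) q.1 q.2.1.1 q.2.1.2 1| + 2 * ((4 * (N : ℝ≥0) ^ 3 : ℝ≥0) : ℝ) :=
  ⟨continuous_of_isLipschitzCylinder (isLipschitzCylinder_zdPlaquetteObs (N := N) q.1 q.2.2),
    fun U => (isLipschitzCylinder_zdPlaquetteObs (N := N) q.1 q.2.2).abs_le U⟩

/-- **Torus plaquette covariances converge** to those of the unique DLR state (`SU(N)`, modulus window). -/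
theorem tendsto_cov_plaquette_dim (hd : 2 ≤ d) (hN : 1 ≤ N) {R K b₁ : ℝ} (hK0 : 0 ≤ K)
    (hmod : OneLinkKRModulus N R K) (hR : b₁ / N * (2 * ((d : ℝ) - 1)) ≤ R) (hdoor : doorPoly d (K * (b₁ / N)) < 1) {b : ℝ} (h0 : 0 ≤ b) (hb : b ≤ b₁)
    {μ : Measure (LGConfig d (Matrix.specialUnitaryGroup (Fin N) ℂ))}
    (hμ : μ ∈ ymGibbsMeasures (d := d) (fundamentalRep (Fin N)) b)
    {F : LGConfig d (Matrix.specialUnitaryGroup (Fin N) ℂ) → ℝ} {Λ : Finset (ZdEdge d)} {KF : ℝ≥0}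
    (hF : IsLipschitzCylinder (fundamentalRep (Fin N)) F Λ KF) (q : ZdPlaquette d) :
    Tendsto (fun L : ℕ => cov[F, zdPlaquetteObs (fundamentalRep (Fin N)) q.1 q.2.1.1 q.2.1.2;
        torusState (d := d) (fundamentalRep (Fin N)) b (L + 1)]) atTop
      (𝓝 (cov[F, zdPlaquetteObs (fundamentalRep (Fin N)) q.1 q.2.1.1 q.2.1.2; μ])) := by
  haveI : SecondCountableTopology (Matrix (Fin N) (Fin N) ℂ) :=
    inferInstanceAs (SecondCountableTopology (Fin N → Fin N → ℂ))
  haveI : SecondCountableTopology (Matrix.specialUnitaryGroup (Fin N) ℂ) :=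
    Topology.IsEmbedding.subtypeVal.secondCountableTopology
  have hu := hasUniqueGibbsMeasure_of_modulus_dim hd hN hK0 hmod hR hdoor h0 hb
  obtain ⟨hWc, hWb⟩ := continuous_zdPlaquetteObs_dim (N := N) q
  exact tendsto_cov_torusState_of_subsingleton (d := d) (fundamentalRep (Fin N)) (continuous_fundamentalRep (Fin N))
    hu.1 hμ (continuous_of_isLipschitzCylinder hF) hWc (fun U => hF.abs_le U) hWb

/-- **Domination for DLR states, `SU(N)`**: `|Cov_μ(F, W_q)| ≤ A_N · (e^{−κ/4})^{‖x₀ − x_q‖₁}`,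
`κ = κ_d(R_G^{(d)}(K b₁/N))` — the torus bound `abs_cov_plaquette_torusState_le_dim` passed to the limit. -/
theorem abs_cov_plaquette_le_star_dim (hd : 2 ≤ d) (hN : 1 ≤ N) {R K b₁ : ℝ} (hK0 : 0 ≤ K)
    (hmod : OneLinkKRModulus N R K) (hR : b₁ / N * (2 * ((d : ℝ) - 1)) ≤ R) (hdoor : doorPoly d (K * (b₁ / N)) < 1) {b : ℝ} (h0 : 0 ≤ b) (hb : b ≤ b₁)
    {μ : Measure (LGConfig d (Matrix.specialUnitaryGroup (Fin N) ℂ))}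
    (hμ : μ ∈ ymGibbsMeasures (d := d) (fundamentalRep (Fin N)) b)
    {F : LGConfig d (Matrix.specialUnitaryGroup (Fin N) ℂ) → ℝ} {Λ : Finset (ZdEdge d)} {KF : ℝ≥0}
    (hF : IsLipschitzCylinder (fundamentalRep (Fin N)) F Λ KF)
    {x₀ : Literature.Probability.LatticeModels.Site d} {D : ℕ} (hD : ∀ e ∈ Λ, ‖e.1 - x₀‖ ≤ D) (q : ZdPlaquette d) :
    |cov[F, zdPlaquetteObs (fundamentalRep (Fin N)) q.1 q.2.1.1 q.2.1.2; μ]| ≤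
      4 * (2 * Real.sqrt N) ^ 2 * Real.exp (((1 - gaugeR d (K * (b₁ / N))) ^ 2 / (2 * (2 * gaugeR d (K * (b₁ / N)) * ((2 * d : ℕ) : ℝ) + 1))) * (D + 3)) * ((Λ.card : ℝ) * KF) *
        (16 * (N : ℝ) ^ 3) * Real.exp (-(((1 - gaugeR d (K * (b₁ / N))) ^ 2 / (2 * (2 * gaugeR d (K * (b₁ / N)) * ((2 * d : ℕ) : ℝ) + 1))) / d)) ^ l1 (x₀ - q.1) := by
  have hN0 : (0 : ℝ) < N := by exact_mod_cast (show 0 < N by omega)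
  have hb₁N : 0 ≤ b₁ / N := div_nonneg (h0.trans hb) hN0.le
  obtain ⟨hρ0, hρ1⟩ := gaugeR_dim_coef_lt_one (N := N) hd hK0 hb₁N hdoor
  refine le_of_tendsto (tendsto_cov_plaquette_dim hd hN hK0 hmod hR hdoor h0 hb hμ hF q).abs ?_
  filter_upwards [eventually_gt_atTop (max (4 * D + 4)
    (2 * Literature.Probability.LatticeModels.Site.supNorm (q.1 - x₀)))] with L hL
  obtain ⟨s, hs, hcen, hfix⟩ := exists_centredLift (L + 1) x₀ (d := d)
  have hq : s (Torus.proj (L + 1) q.1) = q.1 := hfix q.1 (by omega)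
  have key := abs_cov_plaquette_torusState_le_dim (L := L + 1) hd b hρ0 hρ1
    (star_window_uniform_dim hd (by omega) hN hK0 hmod hR hdoor h0 hb) hF hD (by omega) hs hcen (Torus.proj (L + 1) q.1) q.2
  rwa [hq] at key

/-- **Summability of the response series, `SU(N)`**: `q ↦ Cov_μ(F, W_q)` is summable for the DLR state at
`0 ≤ b ≤ b₁`. -/
theorem summable_cov_plaquette_star_dim (hd : 2 ≤ d) (hN : 1 ≤ N) {R K b₁ : ℝ} (hK0 : 0 ≤ K)
    (hmod : OneLinkKRModulus N R K) (hR : b₁ / N * (2 * ((d : ℝ) - 1)) ≤ R) (hdoor : doorPoly d (K * (b₁ / N)) < 1) {b : ℝ} (h0 : 0 ≤ b) (hb : b ≤ b₁)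
    {μ : Measure (LGConfig d (Matrix.specialUnitaryGroup (Fin N) ℂ))}
    (hμ : μ ∈ ymGibbsMeasures (d := d) (fundamentalRep (Fin N)) b)
    {F : LGConfig d (Matrix.specialUnitaryGroup (Fin N) ℂ) → ℝ} {Λ : Finset (ZdEdge d)} {KF : ℝ≥0}
    (hF : IsLipschitzCylinder (fundamentalRep (Fin N)) F Λ KF)
    {x₀ : Literature.Probability.LatticeModels.Site d} {D : ℕ} (hD : ∀ e ∈ Λ, ‖e.1 - x₀‖ ≤ D) :
    Summable fun q : ZdPlaquette d => cov[F, zdPlaquetteObs (fundamentalRep (Fin N)) q.1 q.2.1.1 q.2.1.2; μ] := by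
  have hN0 : (0 : ℝ) < N := by exact_mod_cast (show 0 < N by omega)
  have hb₁N : 0 ≤ b₁ / N := div_nonneg (h0.trans hb) hN0.le
  obtain ⟨hρ0, hρ1⟩ := gaugeR_dim_coef_lt_one (N := N) hd hK0 hb₁N hdoor
  have hκ := StarDimLimit.dimRate_pos (d := d) hρ0 hρ1
  have hd0 : (0 : ℝ) < d := by exact_mod_cast (show 0 < d by omega)
  have hr0 : 0 ≤ Real.exp (-(((1 - gaugeR d (K * (b₁ / N))) ^ 2 / (2 * (2 * gaugeR d (K * (b₁ / N)) * ((2 * d : ℕ) : ℝ) + 1))) / d)) := (Real.exp_pos _).le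
  have hr1 : Real.exp (-(((1 - gaugeR d (K * (b₁ / N))) ^ 2 / (2 * (2 * gaugeR d (K * (b₁ / N)) * ((2 * d : ℕ) : ℝ) + 1))) / d)) < 1 := Real.exp_lt_one_iff.2 (neg_neg_of_pos (div_pos hκ hd0))
  have hA : 0 ≤ 4 * (2 * Real.sqrt N) ^ 2 * Real.exp (((1 - gaugeR d (K * (b₁ / N))) ^ 2 / (2 * (2 * gaugeR d (K * (b₁ / N)) * ((2 * d : ℕ) : ℝ) + 1))) * (D + 3)) *
      ((Λ.card : ℝ) * KF) * (16 * (N : ℝ) ^ 3) := by positivity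
  refine Summable.of_norm_bounded (summable_and_tsum_base_le (d := d) hA hr0 hr1 x₀).1 fun q => ?_
  rw [Real.norm_eq_abs]
  exact abs_cov_plaquette_le_star_dim hd hN hK0 hmod hR hdoor h0 hb hμ hF hD q

end OnePlaquette

/-! ### §2 Tannery -/

section Tannery

/-- **The `SU(N)` torus derivatives converge to the response series** (Tannery's theorem): for `0 ≤ b ≤ b₁`, the DLR
state `μ`, and centred lifts `s L` (torus side `L + 1`, centre `x₀`),
`Σ_{y} Σ_{i<j} Cov_{torusState b (L+1)}(F, W_{(s_L y; i,j)}) → Σ_q Cov_μ(F, W_q)`. -/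
theorem tendsto_responseSum_dim (hd : 2 ≤ d) (hN : 1 ≤ N) {R K b₁ : ℝ} (hK0 : 0 ≤ K)
    (hmod : OneLinkKRModulus N R K) (hR : b₁ / N * (2 * ((d : ℝ) - 1)) ≤ R) (hdoor : doorPoly d (K * (b₁ / N)) < 1) {b : ℝ} (h0 : 0 ≤ b) (hb : b ≤ b₁)
    {μ : Measure (LGConfig d (Matrix.specialUnitaryGroup (Fin N) ℂ))}
    (hμ : μ ∈ ymGibbsMeasures (d := d) (fundamentalRep (Fin N)) b)
    {F : LGConfig d (Matrix.specialUnitaryGroup (Fin N) ℂ) → ℝ} {Λ : Finset (ZdEdge d)} {KF : ℝ≥0}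
    (hF : IsLipschitzCylinder (fundamentalRep (Fin N)) F Λ KF)
    {x₀ : Literature.Probability.LatticeModels.Site d} {D : ℕ} (hD : ∀ e ∈ Λ, ‖e.1 - x₀‖ ≤ D)
    (s : ∀ L : ℕ, Site d (L + 1) → Literature.Probability.LatticeModels.Site d)
    (hs : ∀ L y, (Torus.proj (L + 1) (s L y) : Site d (L + 1)) = y)
    (hcen : ∀ L y, torusNorm (y - Torus.proj (L + 1) x₀) = Literature.Probability.LatticeModels.Site.supNorm (s L y - x₀))
    (hfix : ∀ L x, 2 * Literature.Probability.LatticeModels.Site.supNorm (x - x₀) < L + 1 → s L (Torus.proj (L + 1) x) = x) :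
    Tendsto (fun L : ℕ => ∑ y : Site d (L + 1), ∑ p : {p : Fin d × Fin d // p.1 < p.2},
        cov[F, zdPlaquetteObs (fundamentalRep (Fin N)) (s L y) p.1.1 p.1.2;
          torusState (d := d) (fundamentalRep (Fin N)) b (L + 1)]) atTop
      (𝓝 (∑' q : ZdPlaquette d, cov[F, zdPlaquetteObs (fundamentalRep (Fin N)) q.1 q.2.1.1 q.2.1.2; μ])) := by
  classical
  have hN0 : (0 : ℝ) < N := by exact_mod_cast (show 0 < N by omega)
  have hb₁N : 0 ≤ b₁ / N := div_nonneg (h0.trans hb) hN0.le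
  obtain ⟨hρ0, hρ1⟩ := gaugeR_dim_coef_lt_one (N := N) hd hK0 hb₁N hdoor
  have hκ := StarDimLimit.dimRate_pos (d := d) hρ0 hρ1
  have hd0 : (0 : ℝ) < d := by exact_mod_cast (show 0 < d by omega)
  set ρ := gaugeR d (K * (b₁ / N)) with hρ
  set r : ℝ := Real.exp (-(((1 - ρ) ^ 2 / (2 * (2 * ρ * ((2 * d : ℕ) : ℝ) + 1))) / d)) with hr
  set A : ℝ := 4 * (2 * Real.sqrt N) ^ 2 * Real.exp (((1 - ρ) ^ 2 / (2 * (2 * ρ * ((2 * d : ℕ) : ℝ) + 1))) * (D + 3)) * ((Λ.card : ℝ) * KF) * (16 * (N : ℝ) ^ 3)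
    with hA
  have hr0 : 0 ≤ r := (Real.exp_pos _).le
  have hr1 : r < 1 := Real.exp_lt_one_iff.2 (neg_neg_of_pos (div_pos hκ hd0))
  have hA0 : 0 ≤ A := by positivity
  set c : ℕ → ZdPlaquette d → ℝ := fun L q =>
    cov[F, zdPlaquetteObs (fundamentalRep (Fin N)) q.1 q.2.1.1 q.2.1.2;
      torusState (d := d) (fundamentalRep (Fin N)) b (L + 1)] with hc
  set f : ℕ → ZdPlaquette d → ℝ := fun L q =>
    if q.1 ∈ (Finset.univ : Finset (Site d (L + 1))).image (s L) then c L q else 0 with hf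
  have hsinj : ∀ L, Function.Injective (s L) := fun L y y' h => by rw [← hs L y, ← hs L y', h]
  have hsum : ∀ L, ∑ y : Site d (L + 1), ∑ p : {p : Fin d × Fin d // p.1 < p.2}, c L (s L y, p) = ∑' q, f L q := by
    intro L
    set S := (Finset.univ : Finset (Site d (L + 1))).image (s L) with hS
    rw [tsum_eq_sum (s := S ×ˢ (Finset.univ : Finset {p : Fin d × Fin d // p.1 < p.2}))]
    · rw [Finset.sum_product, Finset.sum_image fun y _ y' _ h => hsinj L h]
      refine Finset.sum_congr rfl fun y _ => Finset.sum_congr rfl fun p _ => ?_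
      rw [hf]
      simp only
      rw [if_pos (Finset.mem_image_of_mem _ (Finset.mem_univ y))]
    · intro q hq
      rw [hf]
      simp only
      rw [if_neg]
      intro hq1
      exact hq (Finset.mem_product.2 ⟨hq1, Finset.mem_univ _⟩)
  have hsum' : (fun L : ℕ => ∑ y : Site d (L + 1), ∑ p : {p : Fin d × Fin d // p.1 < p.2},
      cov[F, zdPlaquetteObs (fundamentalRep (Fin N)) (s L y) p.1.1 p.1.2;
        torusState (d := d) (fundamentalRep (Fin N)) b (L + 1)]) = fun L => ∑' q, f L q := by
    funext L; exact hsum L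
  rw [hsum']
  refine tendsto_tsum_of_dominated_convergence (bound := fun q : ZdPlaquette d => A * r ^ l1 (x₀ - q.1))
    (summable_and_tsum_base_le (d := d) hA0 hr0 hr1 x₀).1 (fun q => ?_) ?_
  · have hev : ∀ᶠ L : ℕ in atTop, f L q = c L q := by
      filter_upwards [eventually_gt_atTop (2 * Literature.Probability.LatticeModels.Site.supNorm (q.1 - x₀))] with L hL
      have hq : s L (Torus.proj (L + 1) q.1) = q.1 := hfix L q.1 (by omega)
      have hmem : q.1 ∈ (Finset.univ : Finset (Site d (L + 1))).image (s L) :=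
        Finset.mem_image.2 ⟨Torus.proj (L + 1) q.1, Finset.mem_univ _, hq⟩
      rw [hf]; simp only; rw [if_pos hmem]
    refine Tendsto.congr' (EventuallyEq.symm hev) ?_
    exact tendsto_cov_plaquette_dim hd hN hK0 hmod hR hdoor h0 hb hμ hF q
  · filter_upwards [eventually_gt_atTop (4 * D + 4)] with L hL q
    rw [hf]; simp only
    split_ifs with hmem
    · obtain ⟨y, -, hy⟩ := Finset.mem_image.1 hmem
      rw [Real.norm_eq_abs, hc]; simp only
      rw [← hy]
      exact abs_cov_plaquette_torusState_le_dim (L := L + 1) hd b hρ0 hρ1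
        (star_window_uniform_dim hd (by omega) hN hK0 hmod hR hdoor h0 hb) hF hD (by omega) (hs L) (hcen L) y q.2
    · rw [norm_zero]; positivity

end Tannery

/-! ### §3 Continuity in the coupling -/

section Continuity

/-- **Expectations are continuous in the coupling along any DLR selection** on `[0, b₁]` (`SU(N)`, C-LIP at the star
window). -/
theorem continuousOn_integral_dim (hd : 2 ≤ d) (hN : 1 ≤ N) {R K b₁ : ℝ} (hK0 : 0 ≤ K)
    (hmod : OneLinkKRModulus N R K) (hR : b₁ / N * (2 * ((d : ℝ) - 1)) ≤ R) (hdoor : doorPoly d (K * (b₁ / N)) < 1)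
    {μ : ℝ → Measure (LGConfig d (Matrix.specialUnitaryGroup (Fin N) ℂ))}
    (hμ : ∀ b ∈ Icc (0 : ℝ) b₁, μ b ∈ ymGibbsMeasures (d := d) (fundamentalRep (Fin N)) b)
    {F : LGConfig d (Matrix.specialUnitaryGroup (Fin N) ℂ) → ℝ} {Λ : Finset (ZdEdge d)} {KF : ℝ≥0}
    (hF : IsLipschitzCylinder (fundamentalRep (Fin N)) F Λ KF)
    {x₀ : Literature.Probability.LatticeModels.Site d} {D : ℕ} (hD : ∀ e ∈ Λ, ‖e.1 - x₀‖ ≤ D) :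
    ContinuousOn (fun b => ∫ U, F U ∂(μ b)) (Icc (0 : ℝ) b₁) :=
  continuousOn_of_abs_sub_le fun b hb b' hb' =>
    abs_integral_sub_integral_le_star_dim hd hN hK0 hmod hR hdoor hb.1 hb.2 hb'.1 hb'.2 (hμ b hb) (hμ b' hb') hF hD

/-- **The response series is continuous in the coupling** along any DLR selection on `[0, b₁]` (`SU(N)`). -/
theorem continuousOn_responseSum_dim (hd : 2 ≤ d) (hN : 1 ≤ N) {R K b₁ : ℝ} (hK0 : 0 ≤ K)
    (hmod : OneLinkKRModulus N R K) (hR : b₁ / N * (2 * ((d : ℝ) - 1)) ≤ R) (hdoor : doorPoly d (K * (b₁ / N)) < 1)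
    {μ : ℝ → Measure (LGConfig d (Matrix.specialUnitaryGroup (Fin N) ℂ))}
    (hμ : ∀ b ∈ Icc (0 : ℝ) b₁, μ b ∈ ymGibbsMeasures (d := d) (fundamentalRep (Fin N)) b)
    {F : LGConfig d (Matrix.specialUnitaryGroup (Fin N) ℂ) → ℝ} {Λ : Finset (ZdEdge d)} {KF : ℝ≥0}
    (hF : IsLipschitzCylinder (fundamentalRep (Fin N)) F Λ KF)
    {x₀ : Literature.Probability.LatticeModels.Site d} {D : ℕ} (hD : ∀ e ∈ Λ, ‖e.1 - x₀‖ ≤ D) :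
    ContinuousOn (fun b => ∑' q : ZdPlaquette d,
      cov[F, zdPlaquetteObs (fundamentalRep (Fin N)) q.1 q.2.1.1 q.2.1.2; μ b]) (Icc (0 : ℝ) b₁) := by
  classical
  rcases lt_or_ge b₁ 0 with hneg | hβ₁0
  · rw [Set.Icc_eq_empty (by simpa using hneg)]; exact continuousOn_empty _
  have hN0 : (0 : ℝ) < N := by exact_mod_cast (show 0 < N by omega)
  have hb₁N : 0 ≤ b₁ / N := div_nonneg hβ₁0 hN0.le
  obtain ⟨hρ0, hρ1⟩ := gaugeR_dim_coef_lt_one (N := N) hd hK0 hb₁N hdoor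
  have hκ := StarDimLimit.dimRate_pos (d := d) hρ0 hρ1
  have hd0 : (0 : ℝ) < d := by exact_mod_cast (show 0 < d by omega)
  have hr0 : 0 ≤ Real.exp (-(((1 - gaugeR d (K * (b₁ / N))) ^ 2 / (2 * (2 * gaugeR d (K * (b₁ / N)) * ((2 * d : ℕ) : ℝ) + 1))) / d)) := (Real.exp_pos _).le
  have hr1 : Real.exp (-(((1 - gaugeR d (K * (b₁ / N))) ^ 2 / (2 * (2 * gaugeR d (K * (b₁ / N)) * ((2 * d : ℕ) : ℝ) + 1))) / d)) < 1 := Real.exp_lt_one_iff.2 (neg_neg_of_pos (div_pos hκ hd0))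
  have hA : 0 ≤ 4 * (2 * Real.sqrt N) ^ 2 * Real.exp (((1 - gaugeR d (K * (b₁ / N))) ^ 2 / (2 * (2 * gaugeR d (K * (b₁ / N)) * ((2 * d : ℕ) : ℝ) + 1))) * (D + 3)) *
      ((Λ.card : ℝ) * KF) * (16 * (N : ℝ) ^ 3) := by positivity
  refine continuousOn_tsum (fun q => ?_) (summable_and_tsum_base_le (d := d) hA hr0 hr1 x₀).1
    (fun q b hb => ?_)
  · have hW := isLipschitzCylinder_zdPlaquetteObs (N := N) (d := d) q.1 q.2.2
    obtain ⟨hWc, hWb⟩ := continuous_zdPlaquetteObs_dim (N := N) q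
    have hFb : ∀ U, |F U| ≤ |F 1| + 2 * KF := fun U => hF.abs_le U
    set D' : ℕ := D + Literature.Probability.LatticeModels.Site.supNorm (q.1 - x₀) + 1 with hD'
    have hDq : ∀ e ∈ plaquetteEdges q, ‖e.1 - x₀‖ ≤ D' := by
      intro e he
      have h1' : ‖e.1 - q.1‖ ≤ 1 := norm_fst_sub_le_of_mem_plaquetteEdges he
      have h2' : ‖q.1 - x₀‖ = Literature.Probability.LatticeModels.Site.supNorm (q.1 - x₀) :=
        Literature.Probability.LatticeModels.Site.norm_eq_supNorm _
      calc ‖e.1 - x₀‖ = ‖(e.1 - q.1) + (q.1 - x₀)‖ := by congr 1; abel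
        _ ≤ ‖e.1 - q.1‖ + ‖q.1 - x₀‖ := norm_add_le _ _
        _ ≤ D' := by rw [hD']; push_cast; linarith
    have hDΛ : ∀ e ∈ Λ, ‖e.1 - x₀‖ ≤ D' := fun e he => (hD e he).trans (by rw [hD']; push_cast; linarith)
    have hDU : ∀ e ∈ Λ ∪ plaquetteEdges q, ‖e.1 - x₀‖ ≤ D' := fun e he => by
      rcases Finset.mem_union.1 he with h | h
      · exact hDΛ e h
      · exact hDq e h
    have hFW := isLipschitzCylinder_mul (M₁ := ⟨|F 1| + 2 * KF, by positivity⟩)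
      (M₂ := ⟨|zdPlaquetteObs (d := d) (fundamentalRep (Fin N)) q.1 q.2.1.1 q.2.1.2 1| +
        2 * ((4 * (N : ℝ≥0) ^ 3 : ℝ≥0) : ℝ), by positivity⟩) hF hW hFb hWb
    have c1 := continuousOn_integral_dim hd hN hK0 hmod hR hdoor hμ hFW hDU
    have c2 := continuousOn_integral_dim hd hN hK0 hmod hR hdoor hμ hF hDΛ
    have c3 := continuousOn_integral_dim hd hN hK0 hmod hR hdoor hμ hW hDq
    refine ((c1.sub (c2.mul c3)).congr fun b hb => ?_)
    haveI : IsProbabilityMeasure (μ b) := (hμ b hb).1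
    exact covariance_eq_sub_of_abs_le hF.measurable hW.measurable hFb hWb
  · rw [Real.norm_eq_abs]
    exact abs_cov_plaquette_le_star_dim hd hN hK0 hmod hR hdoor hb.1 hb.2 (hμ b hb) hF hD q

end Continuity

end Summit.Ventures.YMGap.CouplingResponse

end
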